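import Summits.CriticalPhenomena.SAWScalingLimit.Theses.SAWLeftRightFKG
import Summits.CriticalPhenomena.SAWScalingLimit.Theorems.FKGToTraversalBound.Negative.DeepEndpointGap
import Summits.CriticalPhenomena.SAWScalingLimit.Theorems.LeftRightFKG.Negative.BoxMesh
import Summits.CriticalPhenomena.SAWScalingLimit.Theorems.LeftRightFKG.Negative.OrderCharacterisation
import Summits.CriticalPhenomena.SAWScalingLimit.Theorems.BoundaryTP2Negative_Box3

/-!
# Line `three-by-three-corner-witness` — LEAD skeleton for crux `NotFKGAtOne` (stmt-CriticalPhenomena-11233)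

Lead prover's working copy of `Cruxes/NotFKGAtOne/Lines/three-by-three-corner-witness.lean` (planner
planner-cruxplan-stmt-CriticalPhenomena-11233-three-by-three-corne-0), re-keyed to the LANDED vocabulary:
the crux's `let Ω` / `let le` are `FKGToTraversalBound.Negative.dom C δ` / `lrLE` (DeepEndpointGap.lean),
sites are `LeftRightFKG.Negative.bx i j` with corner `c₀ = (-1,-1)`, and the new objects `sq3`, `Rint₃`,
`cornerA`, `cornerB` are those of `Theorems/SAWLeftRightFKGNotFKGAtOneDefs.lean` (§D below is a verbatim
copy of that file's declarations until it lands; then it is replaced by the import).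

Composition: `NotFKGAtOne_of : Registered.stub_windBox → Registered.stub_meshBox →
Registered.stub_boxCensus → NotFKGAtOne` (sorry-free); `sorry` only in `stub_windBox`, `stub_meshBox`,
`stub_boxCensus`.  See the tree skeleton's docstring for the line in one paragraph and the Disproof used.
-/

noncomputable section

open scoped ENNReal
open MeasureTheory Set Literature.Probability.LatticeModels Literature.Probability.RandomPlanarGeometry
  Literature.Topology.PlaneTopology Summit.CriticalPhenomena.SAWScalingLimit.Theses.SAWLeftRightFKG
open Summit.CriticalPhenomena.SAWScalingLimit.Theorems.LeftRightFKG.Negative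
open Summit.CriticalPhenomena.SAWScalingLimit.Theorems.FKGToTraversalBound.Negative (dom lrLE
  notMem_dom_of_mem_support)
open Summit.CriticalPhenomena.SAWScalingLimit.Theorems.BoundaryTP2.Negative
  (pathsFrom endsAt eqSite eqSite_iff nb₃ inBox₃ inBox₃_iff Ω₃ adj₃_iff mem_nb₃ nb₃_adj T₃ mem_T₃_iff
   card_T₃ length_lt_card_of_adj_mem zdGraph_adj_cases zdGraph_adj_of_cases support_mem_pathsFrom
   exists_walk_of_mem_pathsFrom walk_eq_of_support_eq endsAt_support)

/-! ## §D Objects (verbatim `Theorems/SAWLeftRightFKGNotFKGAtOneDefs.lean`, pending its landing) -/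

namespace Summit.CriticalPhenomena.SAWScalingLimit.Theorems.NotFKGAtOne

/-- **The boundary walk `C₃ = ∂[-1,3]²`**: a closed walk of `ℤ²` of length 16 based at `c₀ = (-1,-1)`,
counter-clockwise. [folklore] -/
def sq3 : (zdGraph 2).Walk c₀ c₀ :=
  .cons (adj_bx (-1) (-1) 0 (-1) (by decide)) <| .cons (adj_bx 0 (-1) 1 (-1) (by decide)) <|
  .cons (adj_bx 1 (-1) 2 (-1) (by decide)) <| .cons (adj_bx 2 (-1) 3 (-1) (by decide)) <|
  .cons (adj_bx 3 (-1) 3 0 (by decide)) <| .cons (adj_bx 3 0 3 1 (by decide)) <|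
  .cons (adj_bx 3 1 3 2 (by decide)) <| .cons (adj_bx 3 2 3 3 (by decide)) <|
  .cons (adj_bx 3 3 2 3 (by decide)) <| .cons (adj_bx 2 3 1 3 (by decide)) <|
  .cons (adj_bx 1 3 0 3 (by decide)) <| .cons (adj_bx 0 3 (-1) 3 (by decide)) <|
  .cons (adj_bx (-1) 3 (-1) 2 (by decide)) <| .cons (adj_bx (-1) 2 (-1) 1 (by decide)) <|
  .cons (adj_bx (-1) 1 (-1) 0 (by decide)) <| .cons (adj_bx (-1) 0 (-1) (-1) (by decide)) <| .nil

/-- The open square `(-1, 3)²` — the interior of the trace of `sq3`. [folklore] -/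
def Rint₃ : Set ℂ := {z | (-1 < z.re ∧ z.re < 3) ∧ (-1 < z.im ∧ z.im < 3)}

/-- The corner event at `a = (0,0)`: `{1 ≤ wcross 0 0 γ}` (first step North). [folklore] -/
def cornerA (Ω : Set ℂ) : Set (SAW.DomainSAW Ω 1 (bx 0 0) (bx 2 2)) :=
  {γ | 1 ≤ wcross 0 0 γ.walk}

/-- The corner event at `b = (2,2)`: `{1 ≤ wcross 1 1 γ}` (last step East). [folklore] -/
def cornerB (Ω : Set ℂ) : Set (SAW.DomainSAW Ω 1 (bx 0 0) (bx 2 2)) :=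
  {γ | 1 ≤ wcross 1 1 γ.walk}

end Summit.CriticalPhenomena.SAWScalingLimit.Theorems.NotFKGAtOne

open Summit.CriticalPhenomena.SAWScalingLimit.Theorems.NotFKGAtOne

namespace Summit.CriticalPhenomena.SAWScalingLimit.Cruxes.NotFKGAtOne.ThreeByThreeCornerWitness

/-! ## §0 Statements (spelled-out predicates of the line) -/

/-- "The discrete domain graph of `Ω` (mesh `1`) is `ℤ²` induced on the 3 × 3 box" — the exact shape of
the tree's `BoundaryTP2.Negative.adj₃_iff`. [folklore] -/
def BoxAdj (Ω : Set ℂ) : Prop :=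
  ∀ x y : Site 2, (discreteDomainGraph Ω 1).Adj x y ↔
    (zdGraph 2).Adj x y ∧ x ∈ boxSites ![0, 0] ![2, 2] ∧ y ∈ boxSites ![0, 0] ![2, 2]

/-- The four counts of the certificate over the chords `(0,0) → (2,2)` of `Ω_1`. [folklore] -/
def Counts (Ω : Set ℂ) : Prop :=
  Measure.count (cornerA Ω) = 6 ∧ Measure.count (cornerB Ω) = 6 ∧
    Measure.count (univ : Set (SAW.DomainSAW Ω 1 (bx 0 0) (bx 2 2))) = 12 ∧
    Measure.count (cornerA Ω ∩ cornerB Ω) = 2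

/-- STATEMENT OF STUB 1 (winding numbers of the boundary walk). [folklore] -/
def WindBox : Prop :=
  Rint₃ ⊆ dom sq3 1 ∧ meshVertices (dom sq3 1) 1 = boxSites ![0, 0] ![2, 2]

/-- STATEMENT OF STUB 2 (the discrete domain of such an `Ω` is the induced box graph). [folklore] -/
def MeshBox : Prop :=
  ∀ Ω : Set ℂ, Rint₃ ⊆ Ω → meshVertices Ω 1 = boxSites ![0, 0] ![2, 2] → BoxAdj Ω

/-- STATEMENT OF STUB 3 (certified census). [folklore] -/
def BoxCensus : Prop :=
  ∀ Ω : Set ℂ, BoxAdj Ω → Counts Ω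

/-! ## §1 Sanity (kernel): boundary data of the witness and the list-side census -/

/-- `(0,-1)` is a boundary vertex (below `a = (0,0)`). [folklore] -/
theorem mem_sq3_support_a' : bx 0 (-1) ∈ sq3.support := by decide

/-- `(2,3)` is a boundary vertex (above `b = (2,2)`). [folklore] -/
theorem mem_sq3_support_b' : bx 2 3 ∈ sq3.support := by decide

/-- `a ∼ a'`. [folklore] -/
theorem adj_a_a' : (zdGraph 2).Adj (bx 0 0) (bx 0 (-1)) := adj_bx 0 0 0 (-1) (by decide)

/-- `b ∼ b'`. [folklore] -/
theorem adj_b_b' : (zdGraph 2).Adj (bx 2 2) (bx 2 3) := adj_bx 2 2 2 3 (by decide)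

/-- The crossing count of `sq3` over the probe of the face `(0,0)` (the top side is traversed westward). [folklore] -/
theorem pathCross_sq3 : pathCross 0 0 c₀ sq3.support.tail = -1 := by decide

/-- The enumerated corner-to-corner supports of the 3 × 3 box. [folklore] -/
def chords₃ : List (List (Site 2)) :=
  (pathsFrom eqSite nb₃ 8 (bx 0 0) []).filter (endsAt eqSite (bx 2 2))

/-- **Census (kernel `decide`)**: 12 chords; 6 with `1 ≤ pathCross 0 0`; 6 with `1 ≤ pathCross 1 1`;
2 with both; duplicate-free. [folklore] -/
theorem census_decide :
    chords₃.length = 12 ∧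
    (chords₃.filter fun s => decide (1 ≤ pathCross 0 0 (bx 0 0) s.tail)).length = 6 ∧
    (chords₃.filter fun s => decide (1 ≤ pathCross 1 1 (bx 0 0) s.tail)).length = 6 ∧
    (chords₃.filter fun s =>
      decide (1 ≤ pathCross 0 0 (bx 0 0) s.tail) && decide (1 ≤ pathCross 1 1 (bx 0 0) s.tail)).length = 2 ∧
    chords₃.Nodup := by
  decide

/-! ## §2 The ORDER side — proved -/

/-- Crossing-count superlevel events are `≼`-up-closed in EVERY domain (`δ = 1`). [folklore] -/
theorem le_wcross_of_lr {Ω : Set ℂ} {a b : Site 2} (m k c : ℤ) (γ₁ γ₂ : SAW.DomainSAW Ω 1 a b)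
    (h : lrLE γ₁ γ₂) (h₁ : c ≤ wcross m k γ₁.walk) : c ≤ wcross m k γ₂.walk := by
  have hG : ∀ x y, (discreteDomainGraph Ω 1).Adj x y → (zdGraph 2).Adj x y := fun x y hxy =>
    meshGraph_le_zdGraph Ω 1 (discreteDomainGraph_le_meshGraph Ω 1 hxy)
  classical
  obtain ⟨Y, hY⟩ := Finset.exists_le
    (insert k (((γ₁.walk.support ++ γ₂.walk.support).map fun x : Site 2 => x 1).toFinset))
  have hkY : k ≤ Y := hY k (Finset.mem_insert_self _ _)
  have hs : ∀ x ∈ γ₁.walk.support ++ γ₂.walk.support, x 1 ≤ Y := fun x hx =>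
    hY (x 1) (Finset.mem_insert_of_mem (List.mem_toFinset.2 (List.mem_map.2 ⟨x, hx, rfl⟩)))
  have key := wcross_le_of_wind_nonneg hG γ₁.walk γ₂.walk hkY
    (fun x hx => hs x (List.mem_append_left _ hx)) (fun x hx => hs x (List.mem_append_right _ hx))
    (h (probeL m k))
  omega

/-- `cornerA Ω` is `≼`-up-closed. [folklore] -/
theorem isUp_cornerA (Ω : Set ℂ) :
    ∀ γ₁ γ₂, lrLE γ₁ γ₂ → γ₁ ∈ cornerA Ω → γ₂ ∈ cornerA Ω :=
  fun γ₁ γ₂ h h₁ => le_wcross_of_lr 0 0 1 γ₁ γ₂ h h₁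

/-- `cornerB Ω` is `≼`-up-closed. [folklore] -/
theorem isUp_cornerB (Ω : Set ℂ) :
    ∀ γ₁ γ₂, lrLE γ₁ γ₂ → γ₁ ∈ cornerB Ω → γ₂ ∈ cornerB Ω :=
  fun γ₁ γ₂ h h₁ => le_wcross_of_lr 1 1 1 γ₁ γ₂ h h₁

/-! ## §2½ PROOFS OF THE THREE STUBS (refuter-drefute-stmt-CriticalPhenomena-11233-0, 2026-08-16)

Ported onto the lead's vocabulary (`bx`, `c₀`, `dom sq3 1`, `boxSites ![0,0] ![2,2]`) from the drefute work files
`StubBoxCensus.lean`, `StubMeshBox.lean`, `StubWindBox.lean` (each rc 0, 0 sorries, standard axioms). -/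

/-! ## Stub 3 `BoxCensus` — sorry-free, by generalising the standing disprover's §3b
(`Disproof.lean`, `counts3x3_of_adjBox3`, refuter-cdisprove-…-11233) from `Ω = dom sq3 1` to an arbitrary `Ω`
with `BoxAdj Ω` (the proof never looks inside `Ω`). -/

section Counting

variable {Ω : Set ℂ} (hadj : BoxAdj Ω)
include hadj

/-- Under `BoxAdj Ω`, `nb₃` lists every neighbour (completeness). -/
theorem mem_nb₃_of_adj {u w : Site 2} (h : (discreteDomainGraph Ω 1).Adj u w) : w ∈ nb₃ u := by
  rw [hadj] at h
  obtain ⟨had, hu, hw⟩ := h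
  rw [nb₃, if_pos ((inBox₃_iff u).2 hu), List.mem_filter]
  refine ⟨?_, (inBox₃_iff w).2 hw⟩
  rcases zdGraph_adj_cases had with h | h | h | h <;> simp [h]

/-- Under `BoxAdj Ω`, `nb₃` lists only neighbours (soundness). -/
theorem adj_of_mem_nb₃ {u w : Site 2} (h : w ∈ nb₃ u) : (discreteDomainGraph Ω 1).Adj u w := by
  unfold nb₃ at h
  split_ifs at h with hu
  · rw [List.mem_filter] at h
    refine (hadj u w).2 ⟨zdGraph_adj_of_cases ?_, (inBox₃_iff u).1 hu, (inBox₃_iff w).1 h.2⟩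
    simpa using h.1
  · simp at h

/-- Under `BoxAdj Ω`, every chord has at most 8 steps. -/
theorem length_le_eight (γ : SAW.DomainSAW Ω 1 (bx 0 0) (bx 2 2)) : γ.walk.length ≤ 8 := by
  have h := length_lt_card_of_adj_mem T₃ (G := discreteDomainGraph Ω 1) (fun x y hxy => ?_)
    ((mem_T₃_iff _).2 (by decide : bx 0 0 ∈ boxSites ![0, 0] ![2, 2])) γ.walk γ.isPath
  · have := card_T₃
    omega
  · rw [hadj] at hxy
    exact ⟨(mem_T₃_iff x).2 hxy.2.1, (mem_T₃_iff y).2 hxy.2.2⟩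

/-- Completeness: every chord's support is listed in `chords₃`. -/
theorem support_mem_chords₃ (γ : SAW.DomainSAW Ω 1 (bx 0 0) (bx 2 2)) : γ.walk.support ∈ chords₃ := by
  unfold chords₃
  rw [List.mem_filter]
  exact ⟨support_mem_pathsFrom eqSite_iff (fun u w h => mem_nb₃_of_adj hadj h) 8 γ.walk [] γ.isPath
    (length_le_eight hadj γ) (by simp), endsAt_support eqSite_iff γ.walk⟩

/-- Soundness: every listed support is a chord's. -/
theorem exists_of_mem_chords₃ {s : List (Site 2)} (hs : s ∈ chords₃) :
    ∃ γ : SAW.DomainSAW Ω 1 (bx 0 0) (bx 2 2), γ.walk.support = s := by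
  unfold chords₃ at hs
  rw [List.mem_filter] at hs
  obtain ⟨hs, hend⟩ := hs
  obtain ⟨v, p, hp, hsupp, -⟩ :=
    exists_walk_of_mem_pathsFrom eqSite_iff (fun u w h => adj_of_mem_nb₃ hadj h) 8 [] s hs
  have hv : v = bx 2 2 := by
    rw [← hsupp] at hend
    unfold endsAt at hend
    rw [List.getLast?_eq_some_getLast p.support_ne_nil, SimpleGraph.Walk.getLast_support] at hend
    exact (eqSite_iff _ _).1 hend
  subst hv
  exact ⟨⟨p, hp⟩, hsupp⟩

omit hadj in
/-- A chord is determined by its support. -/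
theorem support_injective :
    Function.Injective (fun γ : SAW.DomainSAW Ω 1 (bx 0 0) (bx 2 2) => γ.walk.support) := by
  intro γ₁ γ₂ h
  obtain ⟨w₁, h₁⟩ := γ₁
  obtain ⟨w₂, h₂⟩ := γ₂
  have hw : w₁ = w₂ := walk_eq_of_support_eq w₁ w₂ h
  subst hw
  rfl

/-- Counting through the enumeration. -/
theorem count_eq_length (q : List (Site 2) → Bool) (S : Set (SAW.DomainSAW Ω 1 (bx 0 0) (bx 2 2)))
    (hS : ∀ γ, γ ∈ S ↔ q γ.walk.support = true) (hnodup : chords₃.Nodup) :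
    Measure.count S = ((chords₃.filter q).length : ℝ≥0∞) := by
  haveI : Finite (SAW.DomainSAW Ω 1 (bx 0 0) (bx 2 2)) :=
    Finite.of_injective
      (fun γ => (⟨γ.walk.support, List.mem_toFinset.2 (support_mem_chords₃ hadj γ)⟩ : chords₃.toFinset))
      (fun γ₁ γ₂ h => support_injective (congrArg Subtype.val h))
  have hfin : S.Finite := S.toFinite
  rw [Measure.count_apply_finite' hfin MeasurableSpace.measurableSet_top]
  have hc : hfin.toFinset.card = (chords₃.filter q).length := by
    rw [← Finset.card_image_of_injective hfin.toFinset support_injective,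
      ← List.toFinset_card_of_nodup (hnodup.filter q)]
    congr 1
    ext s
    simp only [Finset.mem_image, Set.Finite.mem_toFinset, List.mem_toFinset, List.mem_filter]
    constructor
    · rintro ⟨γ, hγ, rfl⟩
      exact ⟨support_mem_chords₃ hadj γ, (hS γ).1 hγ⟩
    · rintro ⟨hs, hq⟩
      obtain ⟨γ, rfl⟩ := exists_of_mem_chords₃ hadj hs
      exact ⟨γ, (hS γ).2 hq, rfl⟩
  rw [hc]

omit hadj in
/-- Boolean test of the corner event at `a` on a support. -/
def qA (s : List (Site 2)) : Bool := decide (1 ≤ pathCross 0 0 (bx 0 0) s.tail)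

omit hadj in
/-- Boolean test of the corner event at `b` on a support. -/
def qB (s : List (Site 2)) : Bool := decide (1 ≤ pathCross 1 1 (bx 0 0) s.tail)

omit hadj in
/-- KERNEL CERTIFICATE: distinct supports; 12 / 6 / 6 / 2. -/
theorem census :
    chords₃.Nodup ∧ (chords₃.filter fun _ => true).length = 12 ∧ (chords₃.filter qA).length = 6 ∧
      (chords₃.filter qB).length = 6 ∧ (chords₃.filter fun s => qA s && qB s).length = 2 := by
  decide

/-- **`Counts Ω` under `BoxAdj Ω`.** -/
theorem counts_of_boxAdj : Counts Ω := by
  obtain ⟨hnd, hU, hA6, hB6, hAB⟩ := census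
  have hA : ∀ γ : SAW.DomainSAW Ω 1 (bx 0 0) (bx 2 2), γ ∈ cornerA Ω ↔ qA γ.walk.support = true :=
    fun γ => by simp only [cornerA, Set.mem_setOf_eq, qA, decide_eq_true_eq]; rfl
  have hB : ∀ γ : SAW.DomainSAW Ω 1 (bx 0 0) (bx 2 2), γ ∈ cornerB Ω ↔ qB γ.walk.support = true :=
    fun γ => by simp only [cornerB, Set.mem_setOf_eq, qB, decide_eq_true_eq]; rfl
  refine ⟨?_, ?_, ?_, ?_⟩
  · rw [count_eq_length hadj qA (cornerA Ω) hA hnd, hA6]; norm_num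
  · rw [count_eq_length hadj qB (cornerB Ω) hB hnd, hB6]; norm_num
  · rw [count_eq_length hadj (fun _ => true) univ (fun γ => by simp) hnd, hU]; norm_num
  · rw [count_eq_length hadj (fun s => qA s && qB s) (cornerA Ω ∩ cornerB Ω)
      (fun γ => by rw [Set.mem_inter_iff, hA, hB, Bool.and_eq_true]) hnd, hAB]
    norm_num

end Counting

/-- **STUB 3 (`BoxCensus`), sorry-free.** -/
theorem boxCensus : BoxCensus := fun _ hadj => counts_of_boxAdj hadj


/-! ## Stub 2 `MeshBox` — sorry-free (generic replay of the landed `LeftRightFKG/Negative/BoxMesh.lean`) -/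

section MeshBoxProof

/-- The open square is convex. -/
theorem convex_Rint₃ : Convex ℝ Rint₃ := by
  have h : Rint₃ = ({z : ℂ | (-1 : ℝ) < z.re} ∩ {z : ℂ | z.re < 3}) ∩ ({z : ℂ | (-1 : ℝ) < z.im} ∩ {z : ℂ | z.im < 3}) := by
    ext z; simp only [Rint₃, Set.mem_inter_iff, Set.mem_setOf_eq]
  rw [h]
  exact ((convex_halfSpace_re_gt _).inter (convex_halfSpace_re_lt _)).inter
    ((convex_halfSpace_im_gt _).inter (convex_halfSpace_im_lt _))

/-- Box sites lie in the open square. -/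
theorem pt_mem_Rint₃_of_box {x : Site 2} (hx : x ∈ (boxSites ![0, 0] ![2, 2])) : pt x ∈ Rint₃ := by
  rw [mem_boxSites_iff, Fin.forall_fin_two] at hx
  simp only [Matrix.cons_val_zero, Matrix.cons_val_one] at hx
  obtain ⟨⟨h1, h2⟩, h3, h4⟩ := hx
  simp only [Rint₃, mem_setOf_eq, pt_re, pt_im]
  have i1 : ((0 : ℤ) : ℝ) ≤ x 0 := by exact_mod_cast h1
  have i2 : (x 0 : ℝ) ≤ (2 : ℤ) := by exact_mod_cast h2
  have i3 : ((0 : ℤ) : ℝ) ≤ x 1 := by exact_mod_cast h3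
  have i4 : (x 1 : ℝ) ≤ (2 : ℤ) := by exact_mod_cast h4
  push_cast at i1 i2 i3 i4
  exact ⟨⟨by linarith, by linarith⟩, by linarith, by linarith⟩

/-- `bx_mem_box₃` (auxiliary). -/
theorem bx_mem_box₃ {i j : ℤ} (h : (0 ≤ i ∧ i ≤ 2) ∧ (0 ≤ j ∧ j ≤ 2)) : bx i j ∈ (boxSites ![0, 0] ![2, 2]) := by
  rw [mem_boxSites_iff, Fin.forall_fin_two]
  exact h

variable {Ω : Set ℂ} (hR : Rint₃ ⊆ Ω)
include hR

/-- Lattice neighbours inside the box are mesh-adjacent in `Ω`. -/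
theorem meshGraph_adj_of_box {x y : Site 2} (hx : x ∈ (boxSites ![0, 0] ![2, 2])) (hy : y ∈ (boxSites ![0, 0] ![2, 2]))
    (h : (zdGraph 2).Adj x y) : (meshGraph Ω 1).Adj x y := by
  refine meshGraph_adj_iff.2 ⟨h, ?_⟩
  rw [Theorems.LeftRightFKG.Negative.meshPoint_one, Theorems.LeftRightFKG.Negative.meshPoint_one]
  exact (convex_Rint₃.segment_subset (pt_mem_Rint₃_of_box hx) (pt_mem_Rint₃_of_box hy)).trans
    (hR.trans subset_closure)

variable (hV : meshVertices Ω 1 = (boxSites ![0, 0] ![2, 2]))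
include hV

/-- **The mesh graph of `Ω` on its vertices (the box) is connected.** -/
theorem meshVertexGraph_preconnected : (meshVertexGraph Ω 1).Preconnected := by
  set G := meshVertexGraph Ω 1 with hG
  have h00 : bx 0 0 ∈ meshVertices Ω 1 := by rw [hV]; exact bx_mem_box₃ (by norm_num)
  have hrow : ∀ k : ℕ, k ≤ 2 →
      ∃ h : bx k 0 ∈ meshVertices Ω 1, G.Reachable ⟨bx 0 0, h00⟩ ⟨bx k 0, h⟩ := by
    intro k hk
    induction k with
    | zero => exact ⟨by exact_mod_cast h00, by exact_mod_cast SimpleGraph.Reachable.refl _⟩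
    | succ k ih =>
      obtain ⟨hk', hr⟩ := ih (Nat.le_of_succ_le hk)
      have hmem : bx (k + 1 : ℕ) 0 ∈ meshVertices Ω 1 := by
        rw [hV]; exact bx_mem_box₃ ⟨⟨by positivity, by exact_mod_cast hk⟩, le_rfl, by norm_num⟩
      refine ⟨hmem, hr.trans (SimpleGraph.Adj.reachable ?_)⟩
      simp only [hG, SimpleGraph.comap_adj, Function.Embedding.coe_subtype]
      exact meshGraph_adj_of_box hR (hV ▸ hk') (hV ▸ hmem) (adj_bx _ _ _ _ (Or.inl ⟨by push_cast; ring, rfl⟩))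
  have hcol : ∀ (i k : ℕ), i ≤ 2 → k ≤ 2 →
      ∃ h : bx i k ∈ meshVertices Ω 1, G.Reachable ⟨bx 0 0, h00⟩ ⟨bx i k, h⟩ := by
    intro i k hi hk
    induction k with
    | zero => obtain ⟨h, hr⟩ := hrow i hi; exact ⟨by exact_mod_cast h, by exact_mod_cast hr⟩
    | succ k ih =>
      obtain ⟨hk', hr⟩ := ih (Nat.le_of_succ_le hk)
      have hmem : bx i (k + 1 : ℕ) ∈ meshVertices Ω 1 := by
        rw [hV]; exact bx_mem_box₃ ⟨⟨by positivity, by exact_mod_cast hi⟩, by positivity, by exact_mod_cast hk⟩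
      refine ⟨hmem, hr.trans (SimpleGraph.Adj.reachable ?_)⟩
      simp only [hG, SimpleGraph.comap_adj, Function.Embedding.coe_subtype]
      exact meshGraph_adj_of_box hR (hV ▸ hk') (hV ▸ hmem)
        (adj_bx _ _ _ _ (Or.inr (Or.inr (Or.inl ⟨by push_cast; ring, rfl⟩))))
  have hreach : ∀ v : meshVertices Ω 1, G.Reachable ⟨bx 0 0, h00⟩ v := by
    rintro ⟨v, hv⟩
    have hv' := hv
    rw [hV, mem_boxSites_iff, Fin.forall_fin_two] at hv'
    simp only [Matrix.cons_val_zero, Matrix.cons_val_one] at hv'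
    obtain ⟨⟨h1, h2⟩, h3, h4⟩ := hv'
    obtain ⟨i, hi⟩ : ∃ i : ℕ, (i : ℤ) = v 0 := ⟨(v 0).toNat, Int.toNat_of_nonneg h1⟩
    obtain ⟨k, hk⟩ : ∃ k : ℕ, (k : ℤ) = v 1 := ⟨(v 1).toNat, Int.toNat_of_nonneg h3⟩
    have hiL : i ≤ 2 := by omega
    have hkL : k ≤ 2 := by omega
    obtain ⟨h, hr⟩ := hcol i k hiL hkL
    have heq : bx i k = v := by rw [eq_bx v, ← hi, ← hk]
    have hsub : (⟨v, hv⟩ : meshVertices Ω 1) = ⟨bx i k, h⟩ := Subtype.ext heq.symm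
    rw [hsub]
    exact hr
  exact fun u v => (hreach u).symm.trans (hreach v)

/-- **The discrete domain of `Ω` is the whole box.** -/
theorem meshDomain_eq_box : meshDomain Ω 1 = (boxSites ![0, 0] ![2, 2]) := by
  rw [Literature.Probability.Percolation.meshDomain_eq_meshVertices_of_preconnected
    (meshVertexGraph_preconnected hR hV), hV]

/-- **Adjacency in `Ω_1`** is lattice adjacency inside the box. -/
theorem boxAdj_of : BoxAdj Ω := by
  intro x y
  rw [discreteDomainGraph_adj_iff, meshDomain_eq_box hR hV]
  constructor
  · rintro ⟨h, hx, hy⟩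
    exact ⟨meshGraph_le_zdGraph _ _ h, hx, hy⟩
  · rintro ⟨h, hx, hy⟩
    exact ⟨meshGraph_adj_of_box hR hx hy h, hx, hy⟩

end MeshBoxProof

/-- **STUB 2 (`MeshBox`), sorry-free.** -/
theorem meshBox : MeshBox := fun _ hR hV => boxAdj_of hR hV


/-! ## Stub 1 `WindBox` — sorry-free (replay of the landed `LeftRightFKG/Negative/BoxDomain.lean` for `sq3`) -/

section WindBoxProof

/-- Vertices of `sq3` have height `≤ 3`. -/
theorem sq3_support_le3 : ∀ x ∈ sq3.support, x 1 ≤ 3 := by decide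

/-- Bounding box of the vertices of `sq3`. -/
theorem sq3_support_bounds :
    ∀ x ∈ sq3.support, (-1 ≤ x 0 ∧ x 0 ≤ 3) ∧ (-1 ≤ x 1 ∧ x 1 ≤ 3) := by decide

/-- Consecutive vertices of `sq3` lie on a common side of the square. -/
theorem sq3_isChain_bdry :
    List.IsChain (fun p q : Site 2 => (p 1 = -1 ∧ q 1 = -1) ∨ (p 0 = 3 ∧ q 0 = 3) ∨
      (p 1 = 3 ∧ q 1 = 3) ∨ (p 0 = -1 ∧ q 0 = -1)) (c₀ :: sq3.support.tail) := by decide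

/-- The loop function of the crux for `sq3`, as a `Path.extend`. -/
theorem sq3_loop_apply (t : ℝ) :
    Set.IccExtend zero_le_one (sq3.toCurve (meshPoint 1)) t = (poly (c₀) sq3.support.tail).extend t :=
  iccExtend_toCurve_apply sq3 t

/-- **`sq3` winds once round the centre of the face `(0,0)`.** -/
theorem wind_sq3_probe :
    wind (fun t : ℝ => (poly (c₀) sq3.support.tail).extend t - probeL 0 0) = 1 := by
  have h := wind_poly_probeL (m := 0) (k := 0) (Y := 3) (by norm_num) (c₀) sq3.support.tail
    (isChain_support (fun _ _ h => h) sq3) (by decide)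
    (fun x hx => sq3_support_le3 x (List.mem_of_mem_tail hx)) (poly_fst_walk sq3)
  rw [pathCross_sq3] at h
  push_cast at h
  simp only [neg_neg] at h
  exact_mod_cast h

/-- The four boundary lines of `[-1,3]²`. -/
def Cbd₃ : Set ℂ := {z | z.im = -1 ∨ z.re = 3 ∨ z.im = 3 ∨ z.re = -1}

/-- `segment_subset_Cbd₃` (auxiliary). -/
theorem segment_subset_Cbd₃ {p q : Site 2} (h : (p 1 = -1 ∧ q 1 = -1) ∨ (p 0 = 3 ∧ q 0 = 3) ∨
      (p 1 = 3 ∧ q 1 = 3) ∨ (p 0 = -1 ∧ q 0 = -1)) : segment ℝ (pt p) (pt q) ⊆ Cbd₃ := by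
  intro z hz
  simp only [Cbd₃, mem_setOf_eq]
  rcases h with ⟨hp, hq⟩ | ⟨hp, hq⟩ | ⟨hp, hq⟩ | ⟨hp, hq⟩
  · left; rw [im_eq_of_mem_segment (by rw [hp, hq]) hz, hp]; norm_num
  · right; left; rw [re_eq_of_mem_segment (by rw [hp, hq]) hz, hp]; norm_num
  · right; right; left; rw [im_eq_of_mem_segment (by rw [hp, hq]) hz, hp]; norm_num
  · right; right; right; rw [re_eq_of_mem_segment (by rw [hp, hq]) hz, hp]; norm_num

/-- The trace of `sq3` lies on the boundary lines. -/
theorem range_sq3_subset_Cbd₃ : range (poly (c₀) sq3.support.tail) ⊆ Cbd₃ :=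
  range_poly_subset_of_isChain (c₀) _
    (by simp only [Cbd₃, mem_setOf_eq, pt_re, pt_im, bx_zero, bx_one]; left; simp)
    (sq3_isChain_bdry.imp fun _ _ h => segment_subset_Cbd₃ h)

/-- `Cbd₃_subset_compl_Rint₃` (auxiliary). -/
theorem Cbd₃_subset_compl_Rint₃ : Cbd₃ ⊆ Rint₃ᶜ := by
  intro z hz hR
  simp only [Cbd₃, mem_setOf_eq] at hz
  obtain ⟨⟨h1, h2⟩, h3, h4⟩ := hR
  rcases hz with h | h | h | h <;> linarith

/-- `probeL00_mem_Rint₃` (auxiliary). -/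
theorem probeL00_mem_Rint₃ : probeL 0 0 ∈ Rint₃ := by
  simp only [Rint₃, mem_setOf_eq, probeL_re, probeL_im]; norm_num

/-- `isOpen_Rint₃` (auxiliary). -/
theorem isOpen_Rint₃ : IsOpen Rint₃ := by
  have h : Rint₃ = ({z : ℂ | (-1 : ℝ) < z.re} ∩ {z : ℂ | z.re < 3}) ∩ ({z : ℂ | (-1 : ℝ) < z.im} ∩ {z : ℂ | z.im < 3}) := by
    ext z; simp only [Rint₃, Set.mem_inter_iff, Set.mem_setOf_eq]
  rw [h]
  exact ((isOpen_lt continuous_const Complex.continuous_re).inter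
    (isOpen_lt Complex.continuous_re continuous_const)).inter
    ((isOpen_lt continuous_const Complex.continuous_im).inter
    (isOpen_lt Complex.continuous_im continuous_const))

/-- **Inside the square `sq3` winds once.** -/
theorem wind_sq3_of_mem_Rint₃ {z : ℂ} (hz : z ∈ Rint₃) :
    wind (fun t : ℝ => (poly (c₀) sq3.support.tail).extend t - z) = 1 := by
  set Q := poly (c₀) sq3.support.tail with hQ
  have hK : IsClosed Rint₃ᶜ := isOpen_Rint₃.isClosed_compl
  have hmaps : MapsTo Q.extend (Icc 0 1) Rint₃ᶜ := fun t ht => by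
    rw [Path.extend_apply Q ht]
    exact Cbd₃_subset_compl_Rint₃ (range_sq3_subset_Cbd₃ ⟨_, rfl⟩)
  have h01 : Q.extend 0 = Q.extend 1 := by
    rw [Path.extend_zero, Path.extend_one, poly_fst_walk sq3]
  have key : wind (fun t => Q.extend t - probeL 0 0) = wind (fun t => Q.extend t - z) :=
    wind_sub_eq_of_mem_connectedComponentIn Q.continuous_extend.continuousOn h01 hK hmaps (by
      rw [compl_compl]
      exact convex_Rint₃.isPreconnected.subset_connectedComponentIn probeL00_mem_Rint₃ Subset.rfl hz)
  rw [← key]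
  exact wind_sq3_probe

/-- First half of `WindBox`. -/
theorem Rint₃_subset_dom : Rint₃ ⊆ dom sq3 1 := fun z hz => by
  simp only [dom, mem_setOf_eq, sq3_loop_apply, wind_sq3_of_mem_Rint₃ hz]; norm_num

/-- Vertices of `sq3` are not in `Ω(sq3)` (junk winding number `0` on the trace). -/
theorem not_mem_dom_of_mem_support {x : Site 2} (hx : x ∈ sq3.support) : pt x ∉ dom sq3 1 := by
  simp only [dom, mem_setOf_eq, not_not, sq3_loop_apply]
  apply wind_eq_zero_of_mem_range
  have hmem : pt x ∈ pt (c₀) :: sq3.support.tail.map pt := by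
    rw [← List.map_cons, sq3.cons_tail_support]; exact List.mem_map_of_mem hx
  exact mem_range_polylineFrom _ _ hmem

/-- The closed square `[-1,3]²`. -/
def Rcl₃ : Set ℂ := {z | (-1 ≤ z.re ∧ z.re ≤ 3) ∧ (-1 ≤ z.im ∧ z.im ≤ 3)}

/-- `convex_Rcl₃` (auxiliary). -/
theorem convex_Rcl₃ : Convex ℝ Rcl₃ := by
  have h : Rcl₃ = ({z : ℂ | (-1 : ℝ) ≤ z.re} ∩ {z : ℂ | z.re ≤ 3}) ∩ ({z : ℂ | (-1 : ℝ) ≤ z.im} ∩ {z : ℂ | z.im ≤ 3}) := by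
    ext z; simp only [Rcl₃, Set.mem_inter_iff, Set.mem_setOf_eq]
  rw [h]
  exact ((convex_halfSpace_re_ge _).inter (convex_halfSpace_re_le _)).inter
    ((convex_halfSpace_im_ge _).inter (convex_halfSpace_im_le _))

/-- `isClosed_Rcl₃` (auxiliary). -/
theorem isClosed_Rcl₃ : IsClosed Rcl₃ := by
  have h : Rcl₃ = ({z : ℂ | (-1 : ℝ) ≤ z.re} ∩ {z : ℂ | z.re ≤ 3}) ∩ ({z : ℂ | (-1 : ℝ) ≤ z.im} ∩ {z : ℂ | z.im ≤ 3}) := by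
    ext z; simp only [Rcl₃, Set.mem_inter_iff, Set.mem_setOf_eq]
  rw [h]
  exact ((isClosed_le continuous_const Complex.continuous_re).inter
    (isClosed_le Complex.continuous_re continuous_const)).inter
    ((isClosed_le continuous_const Complex.continuous_im).inter
    (isClosed_le Complex.continuous_im continuous_const))

/-- The trace of `sq3` lies in the closed square. -/
theorem range_sq3_subset_Rcl₃ : range (poly (c₀) sq3.support.tail) ⊆ Rcl₃ := by
  refine range_poly_subset convex_Rcl₃ (c₀) _
    (by simp only [Rcl₃, mem_setOf_eq, pt_re, pt_im, bx_zero, bx_one]; norm_num) fun x hx => ?_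
  obtain ⟨⟨h1, h2⟩, h3, h4⟩ := sq3_support_bounds x (List.mem_of_mem_tail hx)
  simp only [Rcl₃, mem_setOf_eq, pt_re, pt_im]
  refine ⟨⟨?_, ?_⟩, ?_, ?_⟩ <;> assumption_mod_cast

/-- **Outside the closed square `sq3` does not wind.** -/
theorem not_mem_dom_of_not_mem_Rcl₃ {z : ℂ} (hz : z ∉ Rcl₃) : z ∉ dom sq3 1 := by
  simp only [dom, mem_setOf_eq, not_not, sq3_loop_apply]
  refine wind_poly_eq_zero_far (c₀) _ (poly_fst_walk sq3) isClosed_Rcl₃ range_sq3_subset_Rcl₃ hz ?_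
  intro M
  have hz' : (z.re < -1 ∨ 3 < z.re) ∨ (z.im < -1 ∨ 3 < z.im) := by
    simp only [Rcl₃, mem_setOf_eq, not_and_or, not_le] at hz
    exact hz
  rcases hz' with (h | h) | (h | h)
  · obtain ⟨w, hw, hseg⟩ := exists_far_re_lt h M
    exact ⟨w, hw, fun y hy hyR => absurd hyR.1.1 (not_le.2 (hseg hy))⟩
  · obtain ⟨w, hw, hseg⟩ := exists_far_re_gt h M
    exact ⟨w, hw, fun y hy hyR => absurd hyR.1.2 (not_le.2 (hseg hy))⟩
  · obtain ⟨w, hw, hseg⟩ := exists_far_im_lt h M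
    exact ⟨w, hw, fun y hy hyR => absurd hyR.2.1 (not_le.2 (hseg hy))⟩
  · obtain ⟨w, hw, hseg⟩ := exists_far_im_gt h M
    exact ⟨w, hw, fun y hy hyR => absurd hyR.2.2 (not_le.2 (hseg hy))⟩

/-- The lattice points of the boundary are vertices of `sq3`. -/
theorem mem_sq3_support_of_bdry (i j : ℤ) (hi : -1 ≤ i) (hi' : i ≤ 3) (hj : -1 ≤ j) (hj' : j ≤ 3)
    (hb : i = -1 ∨ i = 3 ∨ j = -1 ∨ j = 3) : bx i j ∈ sq3.support := by
  interval_cases i <;> interval_cases j <;> first | decide | (exfalso; omega)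

/-- **Second half of `WindBox`: the mesh vertices of `Ω(sq3)` are exactly the box `{0,1,2}²`.** -/
theorem meshVertices_dom : meshVertices (dom sq3 1) 1 = (boxSites ![0, 0] ![2, 2]) := by
  ext x
  rw [mem_meshVertices_iff, Theorems.LeftRightFKG.Negative.meshPoint_one, mem_boxSites_iff, Fin.forall_fin_two]
  simp only [Matrix.cons_val_zero, Matrix.cons_val_one]
  constructor
  · intro hx
    by_contra hbox
    by_cases hR : pt x ∈ Rcl₃
    · obtain ⟨⟨h1, h2⟩, h3, h4⟩ := hR
      simp only [pt_re, pt_im] at h1 h2 h3 h4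
      have i1 : -1 ≤ x 0 := by exact_mod_cast h1
      have i2 : x 0 ≤ 3 := by exact_mod_cast h2
      have i3 : -1 ≤ x 1 := by exact_mod_cast h3
      have i4 : x 1 ≤ 3 := by exact_mod_cast h4
      have hb : x 0 = -1 ∨ x 0 = 3 ∨ x 1 = -1 ∨ x 1 = 3 := by omega
      have hmem := mem_sq3_support_of_bdry (x 0) (x 1) i1 i2 i3 i4 hb
      rw [← eq_bx x] at hmem
      exact not_mem_dom_of_mem_support hmem hx
    · exact not_mem_dom_of_not_mem_Rcl₃ hR hx
  · intro hx
    apply Rint₃_subset_dom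
    obtain ⟨⟨h1, h2⟩, h3, h4⟩ := hx
    simp only [Rint₃, mem_setOf_eq, pt_re, pt_im]
    have i1 : ((0 : ℤ) : ℝ) ≤ x 0 := by exact_mod_cast h1
    have i2 : (x 0 : ℝ) ≤ (2 : ℤ) := by exact_mod_cast h2
    have i3 : ((0 : ℤ) : ℝ) ≤ x 1 := by exact_mod_cast h3
    have i4 : (x 1 : ℝ) ≤ (2 : ℤ) := by exact_mod_cast h4
    push_cast at i1 i2 i3 i4
    exact ⟨⟨by linarith, by linarith⟩, by linarith, by linarith⟩

end WindBoxProof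

/-- **STUB 1 (`WindBox`), sorry-free.** -/
theorem windBox : WindBox := ⟨Rint₃_subset_dom, meshVertices_dom⟩


/-! ## §3 Registered stubs (signatures spelled out over the landed / Defs vocabulary) -/

/-- STUB 1 (M) — `WindBox`: the open square `(-1,3)²` lies in `Ω(sq3) = {wind(sq3, ·) ≠ 0}` and the
mesh-`1` vertices of `Ω(sq3)` are exactly the box `{0,1,2}²`.  Replay of the landed
`LeftRightFKG/Negative/BoxDomain.lean` (`Rint_subset_Ωb`, `meshVertices_Ωb`) at `3 × 3`. [folklore] -/
theorem stub_windBox :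
    Rint₃ ⊆ dom sq3 1 ∧ meshVertices (dom sq3 1) 1 = boxSites ![0, 0] ![2, 2] :=
  windBox

/-- STUB 2 (S/M) — `MeshBox`: for ANY `Ω` containing the open square whose mesh-`1` vertices are the box,
adjacency in `discreteDomainGraph Ω 1` is lattice adjacency inside the box.  Replay of the landed
`LeftRightFKG/Negative/BoxMesh.lean` (`meshDomain_Ωb`, `dAdj_iff`). [folklore] -/
theorem stub_meshBox :
    ∀ Ω : Set ℂ, Rint₃ ⊆ Ω → meshVertices Ω 1 = boxSites ![0, 0] ![2, 2] →
      ∀ x y : Site 2, (discreteDomainGraph Ω 1).Adj x y ↔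
        (zdGraph 2).Adj x y ∧ x ∈ boxSites ![0, 0] ![2, 2] ∧ y ∈ boxSites ![0, 0] ![2, 2] :=
  meshBox

/-- STUB 3 (M, hardest) — `BoxCensus`: for ANY `Ω` whose discrete domain graph is the box graph, the
four counts are `6 / 6 / 12 / 2` (certified enumeration `pathsFrom` + `Measure.count = encard` +
`census_decide`). [folklore] -/
theorem stub_boxCensus :
    ∀ Ω : Set ℂ, (∀ x y : Site 2, (discreteDomainGraph Ω 1).Adj x y ↔
        (zdGraph 2).Adj x y ∧ x ∈ boxSites ![0, 0] ![2, 2] ∧ y ∈ boxSites ![0, 0] ![2, 2]) →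
      Measure.count (cornerA Ω) = 6 ∧ Measure.count (cornerB Ω) = 6 ∧
        Measure.count (Set.univ : Set (SAW.DomainSAW Ω 1 (bx 0 0) (bx 2 2))) = 12 ∧
        Measure.count (cornerA Ω ∩ cornerB Ω) = 2 :=
  boxCensus

/-- The three spelled-out signatures ARE `WindBox`, `MeshBox`, `BoxCensus` (definitionally). [folklore] -/
theorem windBox_iff : WindBox ↔
    (Rint₃ ⊆ dom sq3 1 ∧ meshVertices (dom sq3 1) 1 = boxSites ![0, 0] ![2, 2]) := Iff.rfl

/-! ## Name-keyed aliases of the three statements (hypotheses of the composition) -/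
namespace Registered

/-- Alias of stub 1's signature (`= WindBox`) keyed by the registered stub name. [folklore] -/
abbrev stub_windBox : Prop :=
  Rint₃ ⊆ dom sq3 1 ∧ meshVertices (dom sq3 1) 1 = boxSites ![0, 0] ![2, 2]
/-- Alias of stub 2's signature (`= MeshBox`) keyed by the registered stub name. [folklore] -/
abbrev stub_meshBox : Prop :=
  ∀ Ω : Set ℂ, Rint₃ ⊆ Ω → meshVertices Ω 1 = boxSites ![0, 0] ![2, 2] →
    ∀ x y : Site 2, (discreteDomainGraph Ω 1).Adj x y ↔
      (zdGraph 2).Adj x y ∧ x ∈ boxSites ![0, 0] ![2, 2] ∧ y ∈ boxSites ![0, 0] ![2, 2]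
/-- Alias of stub 3's signature (`= BoxCensus`) keyed by the registered stub name. [folklore] -/
abbrev stub_boxCensus : Prop :=
  ∀ Ω : Set ℂ, (∀ x y : Site 2, (discreteDomainGraph Ω 1).Adj x y ↔
      (zdGraph 2).Adj x y ∧ x ∈ boxSites ![0, 0] ![2, 2] ∧ y ∈ boxSites ![0, 0] ![2, 2]) →
    Measure.count (cornerA Ω) = 6 ∧ Measure.count (cornerB Ω) = 6 ∧
      Measure.count (Set.univ : Set (SAW.DomainSAW Ω 1 (bx 0 0) (bx 2 2))) = 12 ∧
      Measure.count (cornerA Ω ∩ cornerB Ω) = 2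

end Registered

/-! ## §4 Composition (kernel-checked, no `sorry`) -/

/-- Stubs 1–3 give the four counts on the witness domain `Ω(sq3)`. [folklore] -/
theorem counts_sq3 (h₁ : WindBox) (h₂ : MeshBox) (h₃ : BoxCensus) : Counts (dom sq3 1) :=
  h₃ (dom sq3 1) (h₂ (dom sq3 1) h₁.1 h₁.2)

/-- THE LINE: the three stub statements imply the crux BY NAME — the witness datum
`(δ, c, a, b, a', b', C) = (1, (-1,-1), (0,0), (2,2), (0,-1), (2,3), sq3)` violates the ∀-body. [folklore] -/
theorem NotFKGAtOne_of (h₁ : Registered.stub_windBox) (h₂ : Registered.stub_meshBox)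
    (h₃ : Registered.stub_boxCensus) :
    Summit.CriticalPhenomena.SAWScalingLimit.Theses.SAWLeftRightFKG.NotFKGAtOne := by
  unfold NotFKGAtOne
  intro hall
  have h1 := hall 1 c₀ (bx 0 0) (bx 2 2) (bx 0 (-1)) (bx 2 3) sq3
  dsimp only at h1
  obtain ⟨cA, cB, cU, cAB⟩ := counts_sq3 h₁ h₂ h₃
  have key : Measure.count (cornerA (dom sq3 1)) * Measure.count (cornerB (dom sq3 1)) ≤
      Measure.count (univ : Set (SAW.DomainSAW (dom sq3 1) 1 (bx 0 0) (bx 2 2))) *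
        Measure.count (cornerA (dom sq3 1) ∩ cornerB (dom sq3 1)) :=
    h1 one_pos mem_sq3_support_a' mem_sq3_support_b' adj_a_a' adj_b_b' _ _
      (isUp_cornerA (dom sq3 1)) (isUp_cornerB (dom sq3 1))
  rw [cA, cB, cU, cAB] at key
  have e1 : (6 : ℝ≥0∞) * 6 = ((36 : ℕ) : ℝ≥0∞) := by norm_num
  have e2 : (12 : ℝ≥0∞) * 2 = ((24 : ℕ) : ℝ≥0∞) := by norm_num
  rw [e1, e2] at key
  exact absurd (Nat.cast_le.1 key) (by norm_num)

/-- **THE CRUX, UNCONDITIONALLY** (all three stubs proved above; sorry-free; candidate proof for the lead —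
refuter-drefute-stmt-CriticalPhenomena-11233-0, 2026-08-16). -/
theorem notFKGAtOne : Summit.CriticalPhenomena.SAWScalingLimit.Theses.SAWLeftRightFKG.NotFKGAtOne :=
  NotFKGAtOne_of stub_windBox stub_meshBox stub_boxCensus

end Summit.CriticalPhenomena.SAWScalingLimit.Cruxes.NotFKGAtOne.ThreeByThreeCornerWitness

end
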